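import Summits.BirchSwinnertonDyer.BirchSwinnertonDyer.Theses.TameQuarticManinParity
import Summits.BirchSwinnertonDyer.BirchSwinnertonDyer.Theorems.TameQuarticManinParityTameThreeOfNeronCongruence
import Literature.NumberTheory.EllipticCurves.ModularJacobianNeronDifferentialsTameProofs
import HarnessLib

/-!
# Route `TameQuarticManinParity`, LINE 43 (bsd-idea-3 g12), split glue `TprimeIIIColengthOfALCut`
# (stmt-BirchSwinnertonDyer-24166) — GL43 → DL3 → LP42c → G43 → COL(III), PROVED BY NAME (the planner's `Glue43n.lean`)

Cell `pub/bsd-wall`, D-0145 line `route-BirchSwinnertonDyer-TeichmullerTwistDescent`, seat `bsd-line-ttd-p1` g15.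
BSD is NOT proved by this; Manin's conjecture is not proved by this; GL43 (24162, crux), DL3 (24163), LP42c (24164), G43
(24165, landed separately) are the hypotheses; COL(III) (`TprimeIIIColengthBound`, 24044) stays OPEN. This file closes
ONLY the split glue.

## Proof

G43 turns DL3 ∧ GL43 into the Néron congruence witness N42; LP42c puts that cusp-regular witness into the tame Néron
lattice `Λ'` of the conductor, where the landed lattice-witness lemma `not_dvd_maninConstant_of_latticeWitness`
(G42 file) gives `3 ∤ c`; N38c (`not_dvd_maninConstant_iff_tameColength_le_of_hasTameGoodModel`, `a = 2`, `e = 8`)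
converts it into the colength bound for the given `Λ`. THEOREMS ONLY; axioms `propext`, `Classical.choice`,
`Quot.sound`.
-/

set_option autoImplicit false
-- D-0017: single-problem summit, so `Summit.BirchSwinnertonDyer.BirchSwinnertonDyer.…` repeats a namespace BY DESIGN.
set_option linter.dupNamespace false

namespace Summit.BirchSwinnertonDyer.BirchSwinnertonDyer.Theorems.TameQuarticManinParity

open Summit.BirchSwinnertonDyer.BirchSwinnertonDyer.Theses.TameQuarticManinParity
open Literature.NumberTheory.EllipticCurves.ModularForms

/-- **Split glue of COL(III)** (stmt-BirchSwinnertonDyer-24166), by name: GL43 → DL3 → LP42c → G43 → COL(III).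
[cite: AbbesUllmo1996, Lemme 3.1] [cite: EdixhovenManin1991, §4 Prop. 8] -/
theorem tprimeIIIColengthOfALCut_proof : TprimeIIIColengthOfALCut := by
  unfold TprimeIIIColengthOfALCut TprimeIIIColengthBound
  intro hGL hDL hLP hG43 W _ _ _ hadd ht h3 hgood Λ D hopt hmin hdeg
  have h42 : TprimeIIINeronCongruenceSaturation := hG43 hDL hGL
  have h41 : ¬ (3 : ℤ) ∣ D.maninConstant := by
    obtain ⟨Λ', hΛ'⟩ := hLP W hadd ht
    obtain ⟨g, hrat, hreg, t, ht0, hv, hfg⟩ := h42 W hadd ht h3 D hopt hmin hdeg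
    exact not_dvd_maninConstant_of_latticeWitness Λ' D hopt (hΛ' g hrat hreg) ht0 hv hfg
  exact (Λ.not_dvd_maninConstant_iff_tameColength_le_of_hasTameGoodModel Nat.prime_three (by norm_num)
    D hopt hgood).1 h41

end Summit.BirchSwinnertonDyer.BirchSwinnertonDyer.Theorems.TameQuarticManinParity
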